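import Literature.Analysis.FluidPDE.CarlemanCalculusOpen
import HarnessLib

/-!
# The commutator identity of the `L₂` Carleman method for a general weight (Seregin 2014, (A.1.6))

Analysis/FluidPDE file in the backward-uniqueness track of the decomposition of **ns.S08**
`Literature.Analysis.FluidPDE.ess_endpoint`. The Carleman inequalities of Escauriaza–Seregin–Šverák
(Seregin 2014, App. A.1, Props. 1.2–1.3) are proved by Hörmander's `L₂` method: conjugating the
backward heat operator by `e^φ`, `L v = e^φ(∂ₜ + Δ)(e^{-φ} v) = ∂ₜv + Δv - 2Dv(0,∇φ) - (Δφ)v + q v`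
(`q = |∇φ|² - ∂ₜφ`), splitting `tL = S + A` into its symmetric part
`S v = t(Δv + q v) - v/2` ((A.1.3)) and antisymmetric part
`A v = ½(∂ₜ(tv) + t∂ₜv) - t(div(v ⊗ ∇φ) + ∇v∇φ) = t∂ₜv + v/2 - 2t Dv(0,∇φ) - tΔφ v` ((A.1.4)),
one has `∫ t²|Lv|² = ∫|Sv|² + ∫|Av|² + I`, `I = ∫ [S,A]v·v = 2∫⟪Sv, Av⟫` ((A.1.5)), and the
"simple calculations" give (A.1.6). `FluidPDE/CarlemanFirst` computed `I` for the explicit weight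
of Prop. 1.2 (where `[S, A]` is a multiplication operator); this file proves the identity for a
**general weight** `φ ∈ C^∞(Ω)` on an open `Ω ⊆ ℝ × E`, as needed for Prop. 1.3 (anisotropic
weight on a half-space):

* `qW`, `opSW`, `opAW` — `q`, `S`, `A` for a general `φ` (derivatives of `φ` through `fderiv`;
  spatial gradient `gradX φ` and `divₓ` from `CarlemanCalculusOpen`);
* `integral_sq_mul_inner_fderiv_gradX_lap` — `∫ t²⟪DV(0,∇φ), ΔV⟫ = ½∫ t²Δφ|∇V|² - Σᵢⱼ∫ t²φᵢⱼ⟪∂ⱼV, ∂ᵢV⟫`;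
* `integral_sq_mul_lap_mul_inner_lap` — `∫ t²Δφ⟪V, ΔV⟫ = ½∫ t²Δ²φ|V|² - ∫ t²Δφ|∇V|²`;
* the first-order pairings with the weight `q` (square rule / transport identity);
* `two_mul_integral_inner_opSW_opAW` — **(A.1.6)**:
  `2∫⟪Sv, Av⟫ = ∫ t|∇v|² + 4 Σᵢⱼ ∫ t²φᵢⱼ⟪∂ⱼv, ∂ᵢv⟫ + ∫ t²(∂ₜ²φ - ∂ₜ|∇φ|² - Δ²φ + 2 Dq(0,∇φ))|v|² - ∫ t q|v|²`
  and, via `2∇q·∇φ = 4φᵢⱼφᵢφⱼ - ∂ₜ|∇φ|²` (`two_mul_fderiv_qW_apply_gradX`), the printed form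
  `two_mul_integral_inner_opSW_opAW_printed` with `4Σᵢⱼ∫ t²φᵢⱼφᵢφⱼ|v|² + ∫ t²(∂ₜ²φ - 2∂ₜ|∇φ|² - Δ²φ)|v|²`.

All statements are proved; `v` is smooth, compactly supported with `tsupport v ⊆ Ω ∩ {t ≥ δ}`,
`δ > 0` (the time-polynomial weights are handled by the `δ`-layer lemmas of `CarlemanCalculus`).

## References

* G. Seregin, *Lecture notes on regularity theory for the Navier–Stokes equations*, World
  Scientific 2014, Appendix A.1, (A.1.2)–(A.1.6).
* L. Hörmander, *Linear partial differential operators*, Springer 1963, §8.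
* D. Tataru, *Carleman estimates, unique continuation and applications* (notes, 2000).
-/

noncomputable section

open MeasureTheory Set Function Filter Topology
open scoped InnerProductSpace RealInnerProductSpace

namespace Literature.Analysis.FluidPDE

namespace Carleman

/-! ### The general commutator identity (Seregin 2014, (A.1.5)–(A.1.6)) -/

section Commutator

variable {E : Type*} [NormedAddCommGroup E] [InnerProductSpace ℝ E] [FiniteDimensional ℝ E]
  [MeasurableSpace E] [BorelSpace E]
variable {F : Type*} [NormedAddCommGroup F] [InnerProductSpace ℝ F]

/-- The zeroth-order coefficient `q = |∇ₓφ|² - ∂ₜφ` of the conjugated backward heat operator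
`L v = e^φ(∂ₜ + Δ)(e^{-φ}v) = ∂ₜv + Δv - 2∇v·∇φ - (Δφ)v + q v` (Seregin 2014, display before
(A.1.2)). [cite: Seregin2014, App. A.1 (A.1.2)] -/
def qW (φ : ℝ × E → ℝ) (z : ℝ × E) : ℝ :=
  ‖gradX φ z‖ ^ 2 - dt φ z

/-- The symmetric part `S v = t(Δv + q v) - v/2` of `tL` for a general weight `φ`
(Seregin 2014, (A.1.3)). [cite: Seregin2014, App. A.1 (A.1.3)] -/
def opSW (φ : ℝ × E → ℝ) (V : ℝ × E → F) (z : ℝ × E) : F :=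
  z.1 • (lap V z + qW φ z • V z) - (1 / 2 : ℝ) • V z

/-- The antisymmetric part `A v = ½(∂ₜ(tv) + t∂ₜv) - t(div(v ⊗ ∇φ) + ∇v∇φ)
= t∂ₜv + v/2 - 2t Dv(0, ∇ₓφ) - t(Δφ) v` of `tL` for a general weight `φ`
(Seregin 2014, (A.1.4)). [cite: Seregin2014, App. A.1 (A.1.4)] -/
def opAW (φ : ℝ × E → ℝ) (V : ℝ × E → F) (z : ℝ × E) : F :=
  z.1 • dt V z + (1 / 2 : ℝ) • V z - (2 * z.1) • fderiv ℝ V z (0, gradX φ z) -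
    (z.1 * lap φ z) • V z

variable {Ω : Set (ℝ × E)} {δ : ℝ} {φ : ℝ × E → ℝ} {V : ℝ × E → F}

/-! #### Smoothness on `Ω` of the weight-derived fields -/

section WeightFields

variable (hΩ : IsOpen Ω) (hφ : ContDiffOn ℝ (⊤ : ℕ∞) φ Ω)
include hΩ hφ

omit [FiniteDimensional ℝ E] [MeasurableSpace E] [BorelSpace E] hφ in
/-- Directional derivatives of a weight smooth on `Ω` are smooth on `Ω`. [folklore] -/
theorem contDiffOn_fderiv_apply_const_of_open {ψ : ℝ × E → ℝ} (hψ : ContDiffOn ℝ (⊤ : ℕ∞) ψ Ω)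
    (w : ℝ × E) : ContDiffOn ℝ (⊤ : ℕ∞) (fun z => fderiv ℝ ψ z w) Ω :=
  (hψ.fderiv_of_isOpen hΩ le_rfl).clm_apply contDiffOn_const

omit [FiniteDimensional ℝ E] [MeasurableSpace E] [BorelSpace E] in
/-- `∂ₜφ ∈ C^∞(Ω)`. [folklore] -/
theorem contDiffOn_dt : ContDiffOn ℝ (⊤ : ℕ∞) (dt φ) Ω :=
  contDiffOn_fderiv_apply_const_of_open hΩ hφ _

omit [FiniteDimensional ℝ E] [MeasurableSpace E] [BorelSpace E] in
/-- `∂ₑφ ∈ C^∞(Ω)`. [folklore] -/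
theorem contDiffOn_dx (e : E) : ContDiffOn ℝ (⊤ : ℕ∞) (dx e φ) Ω :=
  contDiffOn_fderiv_apply_const_of_open hΩ hφ _

omit [MeasurableSpace E] [BorelSpace E] in
/-- `∇ₓφ ∈ C^∞(Ω; E)`. [folklore] -/
theorem contDiffOn_gradX : ContDiffOn ℝ (⊤ : ℕ∞) (gradX φ) Ω := by
  unfold gradX
  exact ContDiffOn.sum fun i _ => (contDiffOn_dx hΩ hφ _).smul contDiffOn_const

omit [MeasurableSpace E] [BorelSpace E] hφ in
/-- `Δₓψ ∈ C^∞(Ω)` for `ψ ∈ C^∞(Ω)`. [folklore] -/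
theorem contDiffOn_lap_of_open {ψ : ℝ × E → ℝ} (hψ : ContDiffOn ℝ (⊤ : ℕ∞) ψ Ω) :
    ContDiffOn ℝ (⊤ : ℕ∞) (lap ψ) Ω := by
  unfold lap
  refine ContDiffOn.sum fun i _ => ?_
  exact contDiffOn_fderiv_apply_const_of_open hΩ
    (contDiffOn_fderiv_apply_const_of_open hΩ hψ _) _

omit [MeasurableSpace E] [BorelSpace E] in
/-- `q = |∇ₓφ|² - ∂ₜφ ∈ C^∞(Ω)`. [folklore] -/
theorem contDiffOn_qW : ContDiffOn ℝ (⊤ : ℕ∞) (qW φ) Ω :=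
  ((contDiffOn_gradX hΩ hφ).norm_sq ℝ).sub (contDiffOn_dt hΩ hφ)

end WeightFields

variable (hΩ : IsOpen Ω) (hφ : ContDiffOn ℝ (⊤ : ℕ∞) φ Ω) (hδ : 0 < δ)
  (hV : ContDiff ℝ (⊤ : ℕ∞) V) (hVc : HasCompactSupport V) (hVΩ : tsupport V ⊆ Ω)
  (hVδ : tsupport V ⊆ {z | δ ≤ z.1})
include hΩ hφ hδ hV hVc hVΩ hVδ

/-! #### Integrability of weighted pairings on `Ω` -/

omit hφ hδ hV hVc hVδ in
/-- Weighted pairings `w ⟪X, Y⟫` with `X` vanishing off `tsupport V ⊆ Ω`, `w`, `X`, `Y` continuous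
on `Ω`, `X` compactly supported, are integrable. [folklore] -/
theorem integrable_mul_inner_of_open {w : ℝ × E → ℝ} {X Y : ℝ × E → F}
    (hw : ContinuousOn w Ω) (hX : ContinuousOn X Ω) (hY : ContinuousOn Y Ω)
    (hXc : HasCompactSupport X) (hXs : tsupport X ⊆ tsupport V) :
    Integrable fun z => w z * ⟪X z, Y z⟫ :=
  integrable_of_continuous_hasCompactSupport
    (continuous_mul_inner_of_tsupport_subset hΩ (isClosed_tsupport V) hVΩ hw hX hY fun _ hz =>
      Or.inl (image_eq_zero_of_notMem_tsupport fun h => hz (hXs h)))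
    (hasCompactSupport_mul_inner_left hXc)

omit hφ hδ hVδ in
/-- Weighted squares `w ‖V‖²` with `w` continuous on `Ω` are integrable. [folklore] -/
theorem integrable_mul_norm_sq_of_open {w : ℝ × E → ℝ} (hw : ContinuousOn w Ω) :
    Integrable fun z => w z * ‖V z‖ ^ 2 :=
  integrable_of_continuous_hasCompactSupport
    (continuous_mul_norm_sq_of_tsupport_subset hΩ hw hV.continuous hVΩ)
    (hasCompactSupport_mul_norm_sq hVc)

/-! #### The spatial gradient field: divergence, derivatives -/

omit [MeasurableSpace E] [BorelSpace E] hφ hδ hV hVc hVΩ hVδ in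
/-- `⟪∂_w ∇ₓψ, e⟫ = ∂_w ∂ₑ ψ` on `Ω`. [folklore] -/
theorem inner_fderiv_gradX_apply {ψ : ℝ × E → ℝ} (hψ : ContDiffOn ℝ (⊤ : ℕ∞) ψ Ω) {z : ℝ × E}
    (hz : z ∈ Ω) (w : ℝ × E) (e : E) :
    ⟪fderiv ℝ (gradX ψ) z w, e⟫ = fderiv ℝ (fun y => fderiv ℝ ψ y (0, e)) z w := by
  have hgd : DifferentiableAt ℝ (gradX ψ) z :=
    ((contDiffOn_gradX hΩ hψ).differentiableOn (by simp)).differentiableAt (hΩ.mem_nhds hz)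
  have h1 : fderiv ℝ (fun y => ⟪gradX ψ y, e⟫) z w = ⟪fderiv ℝ (gradX ψ) z w, e⟫ := by
    rw [fderiv_inner_apply ℝ hgd (differentiableAt_const e)]
    have h0 : fderiv ℝ (fun _ : ℝ × E => e) z w = 0 := by rw [fderiv_fun_const]; rfl
    rw [h0, inner_zero_right, zero_add]
  have h2 : (fun y => ⟪gradX ψ y, e⟫) = fun y => fderiv ℝ ψ y (0, e) :=
    funext fun y => inner_gradX ψ y e
  rw [← h1, h2]

omit [MeasurableSpace E] [BorelSpace E] hφ hδ hV hVc hVΩ hVδ in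
/-- **`divₓ ∇ₓψ = Δₓψ`** on `Ω`. [folklore] -/
theorem divX_gradX {ψ : ℝ × E → ℝ} (hψ : ContDiffOn ℝ (⊤ : ℕ∞) ψ Ω) {z : ℝ × E} (hz : z ∈ Ω) :
    divX (gradX ψ) z = lap ψ z := by
  simp only [divX, lap, dx_apply]
  refine Finset.sum_congr rfl fun i _ => ?_
  rw [inner_fderiv_gradX_apply hΩ hψ hz]
  rfl

/-! #### The field `X₃ = DV(0, ∇ₓφ)` and its derivatives -/

omit [MeasurableSpace E] [BorelSpace E] hδ hVc hVδ in
/-- `DV(0, ∇ₓφ)` is `C¹` (smooth on `Ω`, zero off `tsupport V`). [folklore] -/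
theorem contDiff_fderiv_apply_gradX :
    ContDiff ℝ 1 fun z => fderiv ℝ V z (0, gradX φ z) := by
  refine contDiff_of_contDiffOn_of_eq_zero hΩ (isClosed_tsupport V) hVΩ ?_ fun z hz => ?_
  · have h1 : ContDiffOn ℝ 1 (fderiv ℝ V) Ω :=
      ((contDiff_two_of_top hV).fderiv_right (m := 1) le_rfl).contDiffOn
    exact h1.clm_apply (contDiffOn_const.prodMk ((contDiffOn_gradX hΩ hφ).of_le (by exact_mod_cast le_top)))
  · simp [fderiv_of_notMem_tsupport (𝕜 := ℝ) hz]

omit [MeasurableSpace E] [BorelSpace E] hΩ hφ hδ hV hVc hVΩ hVδ in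
/-- `DV(0, ∇ₓφ)` is supported in `tsupport V`. [folklore] -/
theorem tsupport_fderiv_apply_gradX_subset :
    tsupport (fun z => fderiv ℝ V z (0, gradX φ z)) ⊆ tsupport V := by
  refine closure_minimal (fun z hz => ?_) (isClosed_tsupport V)
  by_contra h
  exact hz (by simp [fderiv_of_notMem_tsupport (𝕜 := ℝ) h])

omit [MeasurableSpace E] [BorelSpace E] hΩ hφ hδ hV hVΩ hVδ in
/-- `DV(0, ∇ₓφ)` is compactly supported. [folklore] -/
theorem hasCompactSupport_fderiv_apply_gradX :
    HasCompactSupport fun z => fderiv ℝ V z (0, gradX φ z) :=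
  hVc.mono' ((subset_tsupport _).trans tsupport_fderiv_apply_gradX_subset)

omit [MeasurableSpace E] [BorelSpace E] hδ hVc hVΩ hVδ in
/-- **`∂ᵢ(DV(0, ∇φ)) = D(∂ᵢV)(0, ∇φ) + DV(0, ∂ᵢ∇φ)`** on `Ω`. [folklore] -/
theorem fderiv_fderiv_apply_gradX {z : ℝ × E} (hz : z ∈ Ω) (e : E) :
    fderiv ℝ (fun y => fderiv ℝ V y (0, gradX φ y)) z (0, e) =
      fderiv ℝ (dx e V) z (0, gradX φ z) + fderiv ℝ V z (0, fderiv ℝ (gradX φ) z (0, e)) := by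
  have hd : DifferentiableAt ℝ (fderiv ℝ V) z :=
    (((contDiff_two_of_top hV).fderiv_right (m := 1) le_rfl).differentiable one_ne_zero) z
  have hgd : DifferentiableAt ℝ (gradX φ) z :=
    ((contDiffOn_gradX hΩ hφ).differentiableOn (by simp)).differentiableAt (hΩ.mem_nhds hz)
  have hc : DifferentiableAt ℝ (fun y : ℝ × E => ((0 : ℝ), gradX φ y)) z :=
    (differentiableAt_const _).prodMk hgd
  rw [fderiv_clm_apply hd hc]
  simp only [_root_.add_apply, ContinuousLinearMap.comp_apply, ContinuousLinearMap.flip_apply]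
  rw [DifferentiableAt.fderiv_prodMk (differentiableAt_const _) hgd]
  simp only [fderiv_fun_const, Pi.zero_apply, ContinuousLinearMap.prod_apply]
  rw [((contDiff_two_of_top hV).contDiffAt.isSymmSndFDerivAt (by simp)).eq ((0 : ℝ), e)
    ((0 : ℝ), gradX φ z), ← fderiv_fderiv_apply_const hV]
  simp only [zero_apply]
  rw [add_comm]
  rfl

/-! #### The pairings of `S v` with `A v` (Seregin 2014, "simple calculations" behind (A.1.6)) -/

omit hδ hVδ in
/-- **Pairing `⟪tΔv, -2t Dv(0,∇φ)⟫`, core computation**: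
`∫ t² ⟪DV(0, ∇φ), ΔV⟫ = ½ ∫ t² Δφ |∇V|² - Σᵢⱼ ∫ t² φᵢⱼ ⟪∂ⱼV, ∂ᵢV⟫`
(Green in space, `∂ᵢ(DV(0,∇φ)) = D∂ᵢV(0,∇φ) + DV(0,∂ᵢ∇φ)`, the transport identity with
`div ∇φ = Δφ`, and the frame expansion of `DV(0, ∂ᵢ∇φ)`). [cite: Seregin2014, App. A.1 (A.1.6)] -/
theorem integral_sq_mul_inner_fderiv_gradX_lap :
    ∫ z, z.1 ^ 2 * ⟪fderiv ℝ V z (0, gradX φ z), lap V z⟫ =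
      1 / 2 * (∫ z, z.1 ^ 2 * lap φ z * gradSq V z) -
        ∑ i, ∑ j, ∫ z, z.1 ^ 2 * dx (stdOrthonormalBasis ℝ E i) (dx (stdOrthonormalBasis ℝ E j) φ) z *
          ⟪dx (stdOrthonormalBasis ℝ E j) V z, dx (stdOrthonormalBasis ℝ E i) V z⟫ := by
  set b := stdOrthonormalBasis ℝ E with hb
  set X₃ : ℝ × E → F := fun z => fderiv ℝ V z (0, gradX φ z) with hX₃
  have cX₃ : ContDiff ℝ 1 X₃ := contDiff_fderiv_apply_gradX hΩ hφ hV hVΩ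
  have hX₃c : HasCompactSupport X₃ := hasCompactSupport_fderiv_apply_gradX hVc
  have hX₃s : tsupport X₃ ⊆ tsupport V := tsupport_fderiv_apply_gradX_subset
  have hw : ContDiffOn ℝ 1 (fun z : ℝ × E => z.1 ^ 2) Ω := (contDiff_fst.pow 2).contDiffOn
  have hg2 : ContDiff ℝ 1 (fun t : ℝ => t ^ 2) := contDiff_id.pow 2
  have hdw0 : ∀ z (e : E), fderiv ℝ (fun y : ℝ × E => y.1 ^ 2) z (0, e) = 0 := fun z e => by
    rw [fderiv_comp_fst_apply (g := fun t => t ^ 2) hg2]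
    simp
  have hV0 : ∀ z ∉ Ω, fderiv ℝ V z = 0 := fun z hz =>
    fderiv_of_notMem_tsupport (𝕜 := ℝ) fun h => hz (hVΩ h)
  have hdxV1 : ∀ i, ContDiff ℝ 1 (dx (b i) V) := fun i =>
    (contDiff_dx hV _).of_le (by exact_mod_cast le_top)
  have hdxVΩ : ∀ i, tsupport (dx (b i) V) ⊆ Ω := fun i => (tsupport_dx_subset _ V).trans hVΩ
  have cgφ : ContinuousOn (gradX φ) Ω := (contDiffOn_gradX hΩ hφ).continuousOn
  have clapφ : ContinuousOn (lap φ) Ω := (contDiffOn_lap_of_open hΩ hφ).continuousOn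
  have hgd : ∀ z ∈ Ω, DifferentiableAt ℝ (gradX φ) z := fun z hz =>
    ((contDiffOn_gradX hΩ hφ).differentiableOn (by simp)).differentiableAt (hΩ.mem_nhds hz)
  have cdg : ∀ w, ContinuousOn (fun z => fderiv ℝ (gradX φ) z w) Ω := fun w =>
    ((contDiffOn_gradX hΩ hφ).continuousOn_fderiv_of_isOpen hΩ (by simp)).clm_apply continuousOn_const
  have cφij : ∀ i j, ContinuousOn (fun z => dx (b i) (dx (b j) φ) z) Ω := fun i j =>
    (contDiffOn_fderiv_apply_const_of_open hΩ (contDiffOn_dx hΩ hφ _) _).continuousOn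
  -- ## Green in space
  have hG := integral_mul_inner_lap_of_open hΩ hw cX₃ hX₃c (hX₃s.trans hVΩ) hV hVc
  simp only [← hb] at hG
  have hfirst : ∀ i, ∫ z, fderiv ℝ (fun y : ℝ × E => y.1 ^ 2) z (0, b i) * ⟪X₃ z, dx (b i) V z⟫ = 0 :=
    fun i => by simp [hdw0]
  simp only [hfirst, Finset.sum_const_zero, neg_zero, zero_sub] at hG
  rw [hG]
  -- ## the second sum, term by term
  have iA : ∀ i, Integrable fun z : ℝ × E =>
      z.1 ^ 2 * ⟪fderiv ℝ (dx (b i) V) z (0, gradX φ z), dx (b i) V z⟫ := fun i =>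
    integrable_mul_inner_of_open hΩ hVΩ (w := fun z : ℝ × E => z.1 ^ 2) (continuous_fst.pow 2).continuousOn
      ((((contDiff_two_of_top (contDiff_dx hV (b i))).continuous_fderiv (by simp)).continuousOn.clm_apply
        (continuousOn_const.prodMk cgφ)))
      (contDiff_dx hV _).continuous.continuousOn
      ((hasCompactSupport_dx hVc (b i)).mono' ?_) ?_
  rotate_left
  · intro z hz
    by_contra h
    apply hz
    have : fderiv ℝ (dx (b i) V) z = 0 := fderiv_of_notMem_tsupport (𝕜 := ℝ) h
    simp [this]
  · refine closure_minimal (fun z hz => ?_) (isClosed_tsupport V)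
    by_contra h
    have : fderiv ℝ (dx (b i) V) z = 0 :=
      fderiv_of_notMem_tsupport (𝕜 := ℝ) fun h' => h (tsupport_dx_subset _ V h')
    exact hz (by simp [this])
  have iB : ∀ i, Integrable fun z : ℝ × E =>
      z.1 ^ 2 * ⟪dx (b i) V z, fderiv ℝ V z (0, fderiv ℝ (gradX φ) z (0, b i))⟫ := fun i =>
    integrable_mul_inner_of_open hΩ hVΩ (w := fun z : ℝ × E => z.1 ^ 2) (continuous_fst.pow 2).continuousOn
      (contDiff_dx hV _).continuous.continuousOn
      (((hV.continuous_fderiv (by simp)).continuousOn.clm_apply (continuousOn_const.prodMk (cdg _))))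
      (hasCompactSupport_dx hVc _) (tsupport_dx_subset _ V)
  -- `∫ t²⟪∂ᵢX₃, ∂ᵢV⟫ = ∫ t²⟪D∂ᵢV(0,∇φ), ∂ᵢV⟫ + ∫ t²⟪∂ᵢV, DV(0, ∂ᵢ∇φ)⟫`
  have hsplit : ∀ i, ∫ z : ℝ × E, z.1 ^ 2 * ⟪dx (b i) X₃ z, dx (b i) V z⟫ =
      (∫ z : ℝ × E, z.1 ^ 2 * ⟪fderiv ℝ (dx (b i) V) z (0, gradX φ z), dx (b i) V z⟫) +
        ∫ z : ℝ × E, z.1 ^ 2 * ⟪dx (b i) V z, fderiv ℝ V z (0, fderiv ℝ (gradX φ) z (0, b i))⟫ := by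
    intro i
    rw [← integral_add (iA i) (iB i)]
    refine integral_congr_ae (Eventually.of_forall fun z => ?_)
    show z.1 ^ 2 * ⟪dx (b i) X₃ z, dx (b i) V z⟫ =
      z.1 ^ 2 * ⟪fderiv ℝ (dx (b i) V) z (0, gradX φ z), dx (b i) V z⟫ +
        z.1 ^ 2 * ⟪dx (b i) V z, fderiv ℝ V z (0, fderiv ℝ (gradX φ) z (0, b i))⟫
    by_cases hz : z ∈ Ω
    · rw [dx_apply, hX₃, fderiv_fderiv_apply_gradX hΩ hφ hV hz (b i), inner_add_left,
        real_inner_comm (dx (b i) V z) (fderiv ℝ V z (0, fderiv ℝ (gradX φ) z (0, b i)))]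
      ring
    · have hX0 : fderiv ℝ X₃ z = 0 :=
        fderiv_of_notMem_tsupport (𝕜 := ℝ) fun h => hz (hVΩ (hX₃s h))
      simp [hV0 z hz, hX0]
  -- term A: transport identity with `Y = ∇φ`, `div ∇φ = Δφ`
  have hA : ∀ i, 2 * ∫ z : ℝ × E, z.1 ^ 2 * ⟪fderiv ℝ (dx (b i) V) z (0, gradX φ z), dx (b i) V z⟫ =
      -∫ z : ℝ × E, z.1 ^ 2 * lap φ z * ‖dx (b i) V z‖ ^ 2 := by
    intro i
    rw [two_mul_integral_mul_inner_fderiv_field_self hΩ hw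
      ((contDiffOn_gradX hΩ hφ).of_le (by exact_mod_cast le_top)) (hdxV1 i)
      (hasCompactSupport_dx hVc _) (hdxVΩ i)]
    congr 1
    refine integral_congr_ae (Eventually.of_forall fun z => ?_)
    show (fderiv ℝ (fun y : ℝ × E => y.1 ^ 2) z (0, gradX φ z) + z.1 ^ 2 * divX (gradX φ) z) *
        ‖dx (b i) V z‖ ^ 2 = z.1 ^ 2 * lap φ z * ‖dx (b i) V z‖ ^ 2
    by_cases hz : z ∈ Ω
    · rw [hdw0, divX_gradX hΩ hφ hz, zero_add]
    · simp [hV0 z hz]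
  -- term B: frame expansion of `DV(0, ∂ᵢ∇φ)`
  have iBj : ∀ i j, Integrable fun z : ℝ × E =>
      z.1 ^ 2 * dx (b i) (dx (b j) φ) z * ⟪dx (b j) V z, dx (b i) V z⟫ := fun i j =>
    integrable_mul_inner_of_open hΩ hVΩ ((continuous_fst.pow 2).continuousOn.mul (cφij i j))
      (contDiff_dx hV _).continuous.continuousOn (contDiff_dx hV _).continuous.continuousOn
      (hasCompactSupport_dx hVc _) (tsupport_dx_subset _ V)
  have hB : ∀ i, ∫ z : ℝ × E, z.1 ^ 2 * ⟪dx (b i) V z, fderiv ℝ V z (0, fderiv ℝ (gradX φ) z (0, b i))⟫ =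
      ∑ j, ∫ z : ℝ × E, z.1 ^ 2 * dx (b i) (dx (b j) φ) z * ⟪dx (b j) V z, dx (b i) V z⟫ := by
    intro i
    rw [← integral_finsetSum _ fun j _ => iBj i j]
    refine integral_congr_ae (Eventually.of_forall fun z => ?_)
    show z.1 ^ 2 * ⟪dx (b i) V z, fderiv ℝ V z (0, fderiv ℝ (gradX φ) z (0, b i))⟫ =
      ∑ j, z.1 ^ 2 * dx (b i) (dx (b j) φ) z * ⟪dx (b j) V z, dx (b i) V z⟫
    by_cases hz : z ∈ Ω
    · simp only [dx_apply]
      rw [prod_zero_eq_sum (fderiv ℝ (gradX φ) z (0, b i)), map_sum, inner_sum, Finset.mul_sum]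
      simp only [← hb]
      refine Finset.sum_congr rfl fun j _ => ?_
      rw [map_smul, real_inner_smul_right, inner_fderiv_gradX_apply hΩ hφ hz,
        real_inner_comm (fderiv ℝ V z (0, b j)) (fderiv ℝ V z (0, b i))]
      have e1 : fderiv ℝ (fun y => fderiv ℝ φ y (0, b j)) z (0, b i) =
          fderiv ℝ (dx (b j) φ) z (0, b i) := rfl
      rw [e1]
      ring
    · simp [hV0 z hz]
  -- ## assembly
  have iAn : ∀ i, Integrable fun z : ℝ × E => z.1 ^ 2 * lap φ z * ‖dx (b i) V z‖ ^ 2 := fun i =>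
    integrable_of_continuous_hasCompactSupport
      (continuous_mul_norm_sq_of_tsupport_subset hΩ ((continuous_fst.pow 2).continuousOn.mul clapφ)
        (contDiff_dx hV _).continuous (hdxVΩ i))
      (hasCompactSupport_mul_norm_sq (hasCompactSupport_dx hVc _))
  have hsumA : ∑ i, ∫ z : ℝ × E, z.1 ^ 2 * lap φ z * ‖dx (b i) V z‖ ^ 2 =
      ∫ z : ℝ × E, z.1 ^ 2 * lap φ z * gradSq V z := by
    rw [← integral_finsetSum _ fun i _ => iAn i]
    refine integral_congr_ae (Eventually.of_forall fun z => ?_)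
    show ∑ i, z.1 ^ 2 * lap φ z * ‖dx (b i) V z‖ ^ 2 = z.1 ^ 2 * lap φ z * gradSq V z
    rw [gradSq, Finset.mul_sum]
  have hA' : ∀ i, ∫ z : ℝ × E, z.1 ^ 2 * ⟪fderiv ℝ (dx (b i) V) z (0, gradX φ z), dx (b i) V z⟫ =
      -(1 / 2) * ∫ z : ℝ × E, z.1 ^ 2 * lap φ z * ‖dx (b i) V z‖ ^ 2 := fun i => by
    linarith [hA i]
  rw [Finset.sum_congr rfl fun i _ => hsplit i, Finset.sum_add_distrib,
    Finset.sum_congr rfl fun i _ => hA' i, Finset.sum_congr rfl fun i _ => hB i,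
    ← Finset.mul_sum, hsumA]
  ring

omit hδ hVδ in
/-- **Pairing `⟪tΔv, -tΔφ v⟫`, core computation**:
`∫ t² Δφ ⟪V, ΔV⟫ = ½ ∫ t² Δ²φ |V|² - ∫ t² Δφ |∇V|²`
(Green in space with the weight `t²Δφ`, `Σᵢ ∂ᵢΔφ ∂ᵢV = DV(0, ∇Δφ)`, and the transport identity
with `div ∇Δφ = Δ²φ`). [cite: Seregin2014, App. A.1 (A.1.6)] -/
theorem integral_sq_mul_lap_mul_inner_lap :
    ∫ z, z.1 ^ 2 * lap φ z * ⟪V z, lap V z⟫ =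
      1 / 2 * (∫ z, z.1 ^ 2 * lap (lap φ) z * ‖V z‖ ^ 2) - ∫ z, z.1 ^ 2 * lap φ z * gradSq V z := by
  set b := stdOrthonormalBasis ℝ E with hb
  have hV1 : ContDiff ℝ 1 V := hV.of_le (by exact_mod_cast le_top)
  have hlapφ : ContDiffOn ℝ (⊤ : ℕ∞) (lap φ) Ω := contDiffOn_lap_of_open hΩ hφ
  have hlap2φ : ContDiffOn ℝ (⊤ : ℕ∞) (lap (lap φ)) Ω := contDiffOn_lap_of_open hΩ hlapφ
  have hw : ContDiffOn ℝ 1 (fun z : ℝ × E => z.1 ^ 2 * lap φ z) Ω :=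
    (contDiff_fst.pow 2).contDiffOn.mul (hlapφ.of_le (by exact_mod_cast le_top))
  have hg2 : ContDiff ℝ 1 (fun t : ℝ => t ^ 2) := contDiff_id.pow 2
  have hdw0 : ∀ z (e : E), fderiv ℝ (fun y : ℝ × E => y.1 ^ 2) z (0, e) = 0 := fun z e => by
    rw [fderiv_comp_fst_apply (g := fun t => t ^ 2) hg2]
    simp
  have hV0 : ∀ z ∉ Ω, fderiv ℝ V z = 0 := fun z hz =>
    fderiv_of_notMem_tsupport (𝕜 := ℝ) fun h => hz (hVΩ h)
  have hV00 : ∀ z ∉ Ω, V z = 0 := fun z hz => image_eq_zero_of_notMem_tsupport fun h => hz (hVΩ h)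
  have hdxVΩ : ∀ i, tsupport (dx (b i) V) ⊆ Ω := fun i => (tsupport_dx_subset _ V).trans hVΩ
  have clapφ : ContinuousOn (lap φ) Ω := hlapφ.continuousOn
  have clap2φ : ContinuousOn (lap (lap φ)) Ω := hlap2φ.continuousOn
  have cdlap : ∀ w, ContinuousOn (fun z => fderiv ℝ (lap φ) z w) Ω := fun w =>
    (hlapφ.continuousOn_fderiv_of_isOpen hΩ (by simp)).clm_apply continuousOn_const
  -- `∂ᵢ(t² Δφ) = t² ∂ᵢΔφ` on `Ω`
  have hdw : ∀ z ∈ Ω, ∀ e : E, fderiv ℝ (fun y : ℝ × E => y.1 ^ 2 * lap φ y) z (0, e) =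
      z.1 ^ 2 * fderiv ℝ (lap φ) z (0, e) := by
    intro z hz e
    have hld : DifferentiableAt ℝ (lap φ) z :=
      (hlapφ.differentiableOn (by simp)).differentiableAt (hΩ.mem_nhds hz)
    have hc2 : ContDiff ℝ 1 (fun y : ℝ × E => y.1 ^ 2) := contDiff_fst.pow 2
    have hd2 : DifferentiableAt ℝ (fun y : ℝ × E => y.1 ^ 2) z := hc2.differentiable one_ne_zero z
    rw [fderiv_fun_mul hd2 hld]
    simp only [_root_.add_apply, _root_.smul_apply, smul_eq_mul, hdw0, mul_zero, add_zero]
  -- ## Green in space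
  have hG := integral_mul_inner_lap_of_open hΩ hw hV1 hVc hVΩ hV hVc
  simp only [← hb] at hG
  rw [hG]
  -- first sum: `Σᵢ ∫ t² ∂ᵢΔφ ⟪V, ∂ᵢV⟫ = ∫ t² ⟪DV(0, ∇Δφ), V⟫ = -½ ∫ t² Δ²φ |V|²`
  have i1 : ∀ i, Integrable fun z : ℝ × E => z.1 ^ 2 * fderiv ℝ (lap φ) z (0, b i) * ⟪V z, dx (b i) V z⟫ :=
    fun i => integrable_mul_inner_of_open hΩ hVΩ ((continuous_fst.pow 2).continuousOn.mul (cdlap _))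
      hV.continuous.continuousOn (contDiff_dx hV _).continuous.continuousOn hVc subset_rfl
  have hfirst : ∑ i, ∫ z, fderiv ℝ (fun y : ℝ × E => y.1 ^ 2 * lap φ y) z (0, b i) * ⟪V z, dx (b i) V z⟫ =
      ∫ z : ℝ × E, z.1 ^ 2 * ⟪fderiv ℝ V z (0, gradX (lap φ) z), V z⟫ := by
    have e1 : ∀ i, ∫ z, fderiv ℝ (fun y : ℝ × E => y.1 ^ 2 * lap φ y) z (0, b i) * ⟪V z, dx (b i) V z⟫ =
        ∫ z : ℝ × E, z.1 ^ 2 * fderiv ℝ (lap φ) z (0, b i) * ⟪V z, dx (b i) V z⟫ := by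
      intro i
      refine integral_congr_ae (Eventually.of_forall fun z => ?_)
      show fderiv ℝ (fun y : ℝ × E => y.1 ^ 2 * lap φ y) z (0, b i) * ⟪V z, dx (b i) V z⟫ =
        z.1 ^ 2 * fderiv ℝ (lap φ) z (0, b i) * ⟪V z, dx (b i) V z⟫
      by_cases hz : z ∈ Ω
      · rw [hdw z hz]
      · simp [hV00 z hz]
    rw [Finset.sum_congr rfl fun i _ => e1 i, ← integral_finsetSum _ fun i _ => i1 i]
    refine integral_congr_ae (Eventually.of_forall fun z => ?_)
    show ∑ i, z.1 ^ 2 * fderiv ℝ (lap φ) z (0, b i) * ⟪V z, dx (b i) V z⟫ =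
      z.1 ^ 2 * ⟪fderiv ℝ V z (0, gradX (lap φ) z), V z⟫
    rw [fderiv_apply_gradX, sum_inner, Finset.mul_sum]
    simp only [← hb]
    refine Finset.sum_congr rfl fun i _ => ?_
    simp only [real_inner_smul_left, dx_apply]
    rw [real_inner_comm (V z)]
    ring
  have htr : 2 * ∫ z : ℝ × E, z.1 ^ 2 * ⟪fderiv ℝ V z (0, gradX (lap φ) z), V z⟫ =
      -∫ z : ℝ × E, z.1 ^ 2 * lap (lap φ) z * ‖V z‖ ^ 2 := by
    rw [two_mul_integral_mul_inner_fderiv_field_self hΩ (contDiff_fst.pow 2).contDiffOn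
      ((contDiffOn_gradX hΩ hlapφ).of_le (by exact_mod_cast le_top)) hV1 hVc hVΩ]
    congr 1
    refine integral_congr_ae (Eventually.of_forall fun z => ?_)
    show (fderiv ℝ (fun y : ℝ × E => y.1 ^ 2) z (0, gradX (lap φ) z) +
        z.1 ^ 2 * divX (gradX (lap φ)) z) * ‖V z‖ ^ 2 = z.1 ^ 2 * lap (lap φ) z * ‖V z‖ ^ 2
    by_cases hz : z ∈ Ω
    · rw [hdw0, divX_gradX hΩ hlapφ hz, zero_add]
    · simp [hV00 z hz]
  -- second sum
  have i2 : ∀ i, Integrable fun z : ℝ × E => z.1 ^ 2 * lap φ z * ‖dx (b i) V z‖ ^ 2 := fun i =>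
    integrable_of_continuous_hasCompactSupport
      (continuous_mul_norm_sq_of_tsupport_subset hΩ ((continuous_fst.pow 2).continuousOn.mul clapφ)
        (contDiff_dx hV _).continuous (hdxVΩ i))
      (hasCompactSupport_mul_norm_sq (hasCompactSupport_dx hVc _))
  have hsecond : ∑ i, ∫ z : ℝ × E, z.1 ^ 2 * lap φ z * ⟪dx (b i) V z, dx (b i) V z⟫ =
      ∫ z : ℝ × E, z.1 ^ 2 * lap φ z * gradSq V z := by
    have e1 : ∀ i, ∫ z : ℝ × E, z.1 ^ 2 * lap φ z * ⟪dx (b i) V z, dx (b i) V z⟫ =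
        ∫ z : ℝ × E, z.1 ^ 2 * lap φ z * ‖dx (b i) V z‖ ^ 2 := fun i =>
      integral_congr_ae (Eventually.of_forall fun z => by
        show z.1 ^ 2 * lap φ z * ⟪dx (b i) V z, dx (b i) V z⟫ = z.1 ^ 2 * lap φ z * ‖dx (b i) V z‖ ^ 2
        rw [real_inner_self_eq_norm_sq])
    rw [Finset.sum_congr rfl fun i _ => e1 i, ← integral_finsetSum _ fun i _ => i2 i]
    refine integral_congr_ae (Eventually.of_forall fun z => ?_)
    show ∑ i, z.1 ^ 2 * lap φ z * ‖dx (b i) V z‖ ^ 2 = z.1 ^ 2 * lap φ z * gradSq V z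
    rw [gradSq, Finset.mul_sum]
  rw [hfirst, hsecond]
  linarith [htr]

/-! #### First-order pairings with the weight `q` -/

omit [MeasurableSpace E] [BorelSpace E] hδ hV hVc hVΩ hVδ in
/-- `∂ₜ q = ∂ₜ|∇ₓφ|² - ∂ₜ²φ` on `Ω`. [folklore] -/
theorem dt_qW {z : ℝ × E} (hz : z ∈ Ω) :
    dt (qW φ) z = dt (fun y => ‖gradX φ y‖ ^ 2) z - dt (dt φ) z := by
  have h1 : DifferentiableAt ℝ (fun y => ‖gradX φ y‖ ^ 2) z :=
    (((contDiffOn_gradX hΩ hφ).norm_sq ℝ).differentiableOn (by simp)).differentiableAt (hΩ.mem_nhds hz)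
  have h2 : DifferentiableAt ℝ (dt φ) z :=
    ((contDiffOn_dt hΩ hφ).differentiableOn (by simp)).differentiableAt (hΩ.mem_nhds hz)
  simp only [dt_apply]
  rw [show (qW φ : ℝ × E → ℝ) = fun y => (fun y => ‖gradX φ y‖ ^ 2) y - dt φ y from rfl,
    fderiv_fun_sub h1 h2]
  rfl

omit [MeasurableSpace E] [BorelSpace E] hδ hV hVc hVΩ hVδ in
/-- Directional derivatives of `t² q`: `D(t²q)(z)(s, e) = 2ts q + t² Dq(z)(s, e)` on `Ω`. [folklore] -/
theorem fderiv_sq_mul_qW_apply {z : ℝ × E} (hz : z ∈ Ω) (v : ℝ × E) :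
    fderiv ℝ (fun y : ℝ × E => y.1 ^ 2 * qW φ y) z v =
      2 * z.1 * v.1 * qW φ z + z.1 ^ 2 * fderiv ℝ (qW φ) z v := by
  have hc2 : ContDiff ℝ 1 (fun y : ℝ × E => y.1 ^ 2) := contDiff_fst.pow 2
  have hd2 : DifferentiableAt ℝ (fun y : ℝ × E => y.1 ^ 2) z := hc2.differentiable one_ne_zero z
  have hq : DifferentiableAt ℝ (qW φ : ℝ × E → ℝ) z :=
    ((contDiffOn_qW hΩ hφ).differentiableOn (by simp)).differentiableAt (hΩ.mem_nhds hz)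
  have hg2 : ContDiff ℝ 1 (fun t : ℝ => t ^ 2) := contDiff_id.pow 2
  have hdt2 : fderiv ℝ (fun y : ℝ × E => y.1 ^ 2) z v = 2 * z.1 * v.1 := by
    rw [fderiv_comp_fst_apply (g := fun t => t ^ 2) hg2]
    have : deriv (fun t : ℝ => t ^ 2) z.1 = 2 * z.1 := by
      rw [(hasDerivAt_pow 2 z.1).deriv]; ring
    rw [this]
  rw [fderiv_fun_mul hd2 hq]
  simp only [_root_.add_apply, _root_.smul_apply, smul_eq_mul, hdt2]
  ring

omit hδ hVδ in
/-- **Pairing `⟪t q v, t∂ₜv⟫`**: `2 ∫ t²q ⟪V, ∂ₜV⟫ = -∫ (2tq + t² ∂ₜq) |V|²` (square rule). [cite: Seregin2014, App. A.1 (A.1.6)] -/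
theorem two_mul_integral_sq_mul_qW_mul_inner_dt :
    2 * ∫ z, z.1 ^ 2 * qW φ z * ⟪V z, dt V z⟫ =
      -∫ z, (2 * z.1 * qW φ z + z.1 ^ 2 * dt (qW φ) z) * ‖V z‖ ^ 2 := by
  have hV1 : ContDiff ℝ 1 V := hV.of_le (by exact_mod_cast le_top)
  have hw : ContDiffOn ℝ 1 (fun z : ℝ × E => z.1 ^ 2 * qW φ z) Ω :=
    (contDiff_fst.pow 2).contDiffOn.mul ((contDiffOn_qW hΩ hφ).of_le (by exact_mod_cast le_top))
  have h := two_mul_integral_mul_inner_fderiv_self_of_open hΩ hw hV1 hVc hVΩ (1, 0)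
  simp only [← dt_apply] at h
  rw [h]
  congr 1
  refine integral_congr_ae (Eventually.of_forall fun z => ?_)
  show fderiv ℝ (fun y : ℝ × E => y.1 ^ 2 * qW φ y) z (1, 0) * ‖V z‖ ^ 2 =
    (2 * z.1 * qW φ z + z.1 ^ 2 * dt (qW φ) z) * ‖V z‖ ^ 2
  by_cases hz : z ∈ Ω
  · rw [fderiv_sq_mul_qW_apply hΩ hφ hz, dt_apply]
    ring
  · have : V z = 0 := image_eq_zero_of_notMem_tsupport fun h => hz (hVΩ h)
    simp [this]

omit hδ hVδ in
/-- **Pairing `⟪t q v, -2t Dv(0,∇φ)⟫`**, core: `2 ∫ t²q ⟪DV(0,∇φ), V⟫ = -∫ t² (Dq(0,∇φ) + q Δφ) |V|²`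
(transport identity with `div ∇φ = Δφ`). [cite: Seregin2014, App. A.1 (A.1.6)] -/
theorem two_mul_integral_sq_mul_qW_mul_inner_fderiv_gradX :
    2 * ∫ z, z.1 ^ 2 * qW φ z * ⟪fderiv ℝ V z (0, gradX φ z), V z⟫ =
      -∫ z, z.1 ^ 2 * (fderiv ℝ (qW φ) z (0, gradX φ z) + qW φ z * lap φ z) * ‖V z‖ ^ 2 := by
  have hV1 : ContDiff ℝ 1 V := hV.of_le (by exact_mod_cast le_top)
  have hw : ContDiffOn ℝ 1 (fun z : ℝ × E => z.1 ^ 2 * qW φ z) Ω :=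
    (contDiff_fst.pow 2).contDiffOn.mul ((contDiffOn_qW hΩ hφ).of_le (by exact_mod_cast le_top))
  rw [two_mul_integral_mul_inner_fderiv_field_self hΩ hw
    ((contDiffOn_gradX hΩ hφ).of_le (by exact_mod_cast le_top)) hV1 hVc hVΩ]
  congr 1
  refine integral_congr_ae (Eventually.of_forall fun z => ?_)
  show (fderiv ℝ (fun y : ℝ × E => y.1 ^ 2 * qW φ y) z (0, gradX φ z) +
      z.1 ^ 2 * qW φ z * divX (gradX φ) z) * ‖V z‖ ^ 2 =
    z.1 ^ 2 * (fderiv ℝ (qW φ) z (0, gradX φ z) + qW φ z * lap φ z) * ‖V z‖ ^ 2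
  by_cases hz : z ∈ Ω
  · rw [fderiv_sq_mul_qW_apply hΩ hφ hz, divX_gradX hΩ hφ hz]
    ring
  · have : V z = 0 := image_eq_zero_of_notMem_tsupport fun h => hz (hVΩ h)
    simp [this]

omit hφ hδ hVδ in
/-- **Pairing `⟪-v/2, -2t Dv(0,∇φ)⟫`**, core: `2 ∫ t ⟪DV(0,∇φ), V⟫ = -∫ t Δφ |V|²`. [cite: Seregin2014, App. A.1 (A.1.6)] -/
theorem two_mul_integral_fst_mul_inner_fderiv_gradX (hφ' : ContDiffOn ℝ (⊤ : ℕ∞) φ Ω) :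
    2 * ∫ z, z.1 * ⟪fderiv ℝ V z (0, gradX φ z), V z⟫ = -∫ z, z.1 * lap φ z * ‖V z‖ ^ 2 := by
  have hV1 : ContDiff ℝ 1 V := hV.of_le (by exact_mod_cast le_top)
  rw [two_mul_integral_mul_inner_fderiv_field_self hΩ contDiff_fst.contDiffOn
    ((contDiffOn_gradX hΩ hφ').of_le (by exact_mod_cast le_top)) hV1 hVc hVΩ]
  congr 1
  refine integral_congr_ae (Eventually.of_forall fun z => ?_)
  show (fderiv ℝ (fun y : ℝ × E => y.1) z (0, gradX φ z) + z.1 * divX (gradX φ) z) * ‖V z‖ ^ 2 =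
    z.1 * lap φ z * ‖V z‖ ^ 2
  by_cases hz : z ∈ Ω
  · rw [fderiv_fst_apply, divX_gradX hΩ hφ' hz, zero_add]
  · have : V z = 0 := image_eq_zero_of_notMem_tsupport fun h => hz (hVΩ h)
    simp [this]

/-! #### The commutator identity (A.1.5)–(A.1.6) for a general weight -/

/-- **The general commutator identity** (Seregin 2014, (A.1.5)–(A.1.6); Hörmander's `L₂`
method): for an open `Ω ⊆ ℝ × E`, a weight `φ ∈ C^∞(Ω)`, and `v ∈ C_c^∞` with
`tsupport v ⊆ Ω ∩ {t ≥ δ}` (`δ > 0`), the symmetric and antisymmetric parts `S`, `A` of `tL`,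
`L v = e^φ(∂ₜ + Δ)(e^{-φ}v)`, satisfy
`2 ∫ ⟪S v, A v⟫ = ∫ t|∇v|² + 4 Σᵢⱼ ∫ t² φᵢⱼ ⟪∂ⱼv, ∂ᵢv⟫
  + ∫ t² (∂ₜ²φ - ∂ₜ|∇φ|² - Δ²φ + 2 ∇q·∇φ) |v|² - ∫ t q |v|²`, `q = |∇φ|² - ∂ₜφ`
— this is `I = ∫ [S, A]v·v` of (A.1.6) (there `2∇q·∇φ` is expanded as `4φᵢⱼφᵢφⱼ - ∂ₜ|∇φ|²`),
so that `∫ t²|Lv|² = ∫ |Sv|² + ∫ |Av|² + I` ((A.1.5)). The twelve pairings of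
`S v = tΔv + tq v - v/2` with `A v = t∂ₜv + v/2 - 2t Dv(0,∇φ) - tΔφ v` are evaluated by Green's
formula in space, the square rule, and the transport identity (`FluidPDE/CarlemanCalculusOpen`).
[cite: Seregin2014, App. A.1 (A.1.6)] -/
theorem two_mul_integral_inner_opSW_opAW :
    2 * ∫ z, ⟪opSW φ V z, opAW φ V z⟫ =
      (∫ z, z.1 * gradSq V z) +
      4 * (∑ i, ∑ j, ∫ z, z.1 ^ 2 * dx (stdOrthonormalBasis ℝ E i) (dx (stdOrthonormalBasis ℝ E j) φ) z *
          ⟪dx (stdOrthonormalBasis ℝ E j) V z, dx (stdOrthonormalBasis ℝ E i) V z⟫) +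
      (∫ z, z.1 ^ 2 * (dt (dt φ) z - dt (fun y => ‖gradX φ y‖ ^ 2) z - lap (lap φ) z +
          2 * fderiv ℝ (qW φ) z (0, gradX φ z)) * ‖V z‖ ^ 2) -
      ∫ z, z.1 * qW φ z * ‖V z‖ ^ 2 := by
  set X₃ : ℝ × E → F := fun z => fderiv ℝ V z (0, gradX φ z) with hX₃
  set H : ℝ := ∑ i, ∑ j, ∫ z, z.1 ^ 2 * dx (stdOrthonormalBasis ℝ E i) (dx (stdOrthonormalBasis ℝ E j) φ) z *
    ⟪dx (stdOrthonormalBasis ℝ E j) V z, dx (stdOrthonormalBasis ℝ E i) V z⟫ with hH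
  have hV1 : ContDiff ℝ 1 V := hV.of_le (by exact_mod_cast le_top)
  have hV00 : ∀ z ∉ Ω, V z = 0 := fun z hz => image_eq_zero_of_notMem_tsupport fun h => hz (hVΩ h)
  -- continuity on `Ω`
  have cq : ContinuousOn (qW φ) Ω := (contDiffOn_qW hΩ hφ).continuousOn
  have clapφ : ContinuousOn (lap φ) Ω := (contDiffOn_lap_of_open hΩ hφ).continuousOn
  have clap2φ : ContinuousOn (lap (lap φ)) Ω := (contDiffOn_lap_of_open hΩ (contDiffOn_lap_of_open hΩ hφ)).continuousOn
  have cdtdt : ContinuousOn (dt (dt φ)) Ω :=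
    (contDiffOn_fderiv_apply_const_of_open hΩ (contDiffOn_dt hΩ hφ) _).continuousOn
  have cdtg : ContinuousOn (dt (fun y => ‖gradX φ y‖ ^ 2)) Ω :=
    (contDiffOn_fderiv_apply_const_of_open hΩ ((contDiffOn_gradX hΩ hφ).norm_sq ℝ) _).continuousOn
  have cdq : ContinuousOn (fun z => fderiv ℝ (qW φ) z (0, gradX φ z)) Ω :=
    ((contDiffOn_qW hΩ hφ).continuousOn_fderiv_of_isOpen hΩ (by simp)).clm_apply
      (continuousOn_const.prodMk (contDiffOn_gradX hΩ hφ).continuousOn)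
  have cdtq : ContinuousOn (dt (qW φ)) Ω :=
    (contDiffOn_fderiv_apply_const_of_open hΩ (contDiffOn_qW hΩ hφ) _).continuousOn
  have cX₃ : Continuous X₃ := (contDiff_fderiv_apply_gradX hΩ hφ hV hVΩ).continuous
  have cV : Continuous V := hV.continuous
  have cdt : Continuous (dt V) := (contDiff_dt hV).continuous
  have clap : Continuous (lap V) := (contDiff_lap hV).continuous
  have ct : ContinuousOn (fun z : ℝ × E => z.1) Ω := continuous_fst.continuousOn
  have ct2 : ContinuousOn (fun z : ℝ × E => z.1 ^ 2) Ω := (continuous_fst.pow 2).continuousOn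
  -- ## pointwise expansion of `⟪S v, A v⟫`
  set Zw : ℝ × E → ℝ := fun z => z.1 * qW φ z / 2 - z.1 ^ 2 * qW φ z * lap φ z - 1 / 4 +
    z.1 * lap φ z / 2 with hZw
  have hexp : ∀ z, ⟪opSW φ V z, opAW φ V z⟫ =
      z.1 ^ 2 * ⟪lap V z, dt V z⟫ + 1 / 2 * (z.1 * ⟪lap V z, V z⟫) +
        (-2) * (z.1 ^ 2 * ⟪lap V z, X₃ z⟫) + (-(z.1 ^ 2 * lap φ z * ⟪lap V z, V z⟫)) +
        z.1 ^ 2 * qW φ z * ⟪V z, dt V z⟫ + (-2) * (z.1 ^ 2 * qW φ z * ⟪V z, X₃ z⟫) +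
        (-(1 / 2)) * (z.1 * ⟪V z, dt V z⟫) + z.1 * ⟪V z, X₃ z⟫ + Zw z * ‖V z‖ ^ 2 := by
    intro z
    simp only [opSW, opAW, hX₃, hZw, smul_add, inner_add_left, inner_sub_left, inner_add_right,
      inner_sub_right, real_inner_smul_left, real_inner_smul_right]
    simp only [real_inner_self_eq_norm_sq]
    ring
  -- ## integrability
  have i1 : Integrable fun z : ℝ × E => z.1 ^ 2 * ⟪lap V z, dt V z⟫ :=
    integrable_mul_inner_of_open hΩ hVΩ ct2 clap.continuousOn cdt.continuousOn
      (hasCompactSupport_lap hVc) (tsupport_lap_subset V)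
  have i2 : Integrable fun z : ℝ × E => 1 / 2 * (z.1 * ⟪lap V z, V z⟫) :=
    (integrable_mul_inner_of_open hΩ hVΩ ct clap.continuousOn cV.continuousOn
      (hasCompactSupport_lap hVc) (tsupport_lap_subset V)).const_mul _
  have i3 : Integrable fun z : ℝ × E => (-2) * (z.1 ^ 2 * ⟪lap V z, X₃ z⟫) :=
    (integrable_mul_inner_of_open hΩ hVΩ ct2 clap.continuousOn cX₃.continuousOn
      (hasCompactSupport_lap hVc) (tsupport_lap_subset V)).const_mul _
  have i4 : Integrable fun z : ℝ × E => -(z.1 ^ 2 * lap φ z * ⟪lap V z, V z⟫) :=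
    (integrable_mul_inner_of_open hΩ hVΩ (ct2.mul clapφ) clap.continuousOn cV.continuousOn
      (hasCompactSupport_lap hVc) (tsupport_lap_subset V)).neg
  have i5 : Integrable fun z : ℝ × E => z.1 ^ 2 * qW φ z * ⟪V z, dt V z⟫ :=
    integrable_mul_inner_of_open hΩ hVΩ (ct2.mul cq) cV.continuousOn cdt.continuousOn hVc subset_rfl
  have i7 : Integrable fun z : ℝ × E => (-2) * (z.1 ^ 2 * qW φ z * ⟪V z, X₃ z⟫) :=
    (integrable_mul_inner_of_open hΩ hVΩ (ct2.mul cq) cV.continuousOn cX₃.continuousOn hVc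
      subset_rfl).const_mul _
  have i9 : Integrable fun z : ℝ × E => (-(1 / 2)) * (z.1 * ⟪V z, dt V z⟫) :=
    (integrable_mul_inner_of_open hΩ hVΩ ct cV.continuousOn cdt.continuousOn hVc subset_rfl).const_mul _
  have i11 : Integrable fun z : ℝ × E => z.1 * ⟪V z, X₃ z⟫ :=
    integrable_mul_inner_of_open hΩ hVΩ ct cV.continuousOn cX₃.continuousOn hVc subset_rfl
  have cZw : ContinuousOn Zw Ω :=
    ((((ct.mul cq).div_const _).sub ((ct2.mul cq).mul clapφ)).sub continuousOn_const).add
      ((ct.mul clapφ).div_const _)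
  have iZ : Integrable fun z : ℝ × E => Zw z * ‖V z‖ ^ 2 := integrable_mul_norm_sq_of_open hΩ hV hVc hVΩ cZw
  -- ## evaluation of the pairings
  have hg2 : ContDiff ℝ 1 (fun t : ℝ => t ^ 2) := contDiff_id.pow 2
  have hd2 : ∀ t : ℝ, deriv (fun t : ℝ => t ^ 2) t = 2 * t := fun t => by
    rw [(hasDerivAt_pow 2 t).deriv]; ring
  have E1 : 2 * ∫ z : ℝ × E, z.1 ^ 2 * ⟪lap V z, dt V z⟫ = 2 * ∫ z : ℝ × E, z.1 * gradSq V z := by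
    have h := integral_mul_inner_dt_lap hδ hV hVc hVδ (g := fun t => t ^ 2) hg2
    have e : ∫ z : ℝ × E, z.1 ^ 2 * ⟪lap V z, dt V z⟫ = ∫ z : ℝ × E, z.1 ^ 2 * ⟪dt V z, lap V z⟫ :=
      integral_congr_ae (Eventually.of_forall fun z => by
        show z.1 ^ 2 * ⟪lap V z, dt V z⟫ = z.1 ^ 2 * ⟪dt V z, lap V z⟫; rw [real_inner_comm])
    rw [e, h]
    simp only [hd2]
    rw [show (fun z : ℝ × E => 2 * z.1 * gradSq V z) = fun z => 2 * (z.1 * gradSq V z) from by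
      funext z; ring, integral_const_mul]
    ring
  have E2 : 2 * ∫ z : ℝ × E, 1 / 2 * (z.1 * ⟪lap V z, V z⟫) = -∫ z : ℝ × E, z.1 * gradSq V z := by
    have h := integral_mul_inner_lap_self hδ hV hVc hVδ (g := fun t => t) contDiff_id
    rw [integral_const_mul]
    have e : ∫ z : ℝ × E, z.1 * ⟪lap V z, V z⟫ = ∫ z : ℝ × E, z.1 * ⟪V z, lap V z⟫ :=
      integral_congr_ae (Eventually.of_forall fun z => by
        show z.1 * ⟪lap V z, V z⟫ = z.1 * ⟪V z, lap V z⟫; rw [real_inner_comm])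
    rw [e, h]
    ring
  have E3 : 2 * ∫ z : ℝ × E, (-2) * (z.1 ^ 2 * ⟪lap V z, X₃ z⟫) =
      -2 * (∫ z : ℝ × E, z.1 ^ 2 * lap φ z * gradSq V z) + 4 * H := by
    have h := integral_sq_mul_inner_fderiv_gradX_lap hΩ hφ hV hVc hVΩ
    rw [integral_const_mul]
    have e : ∫ z : ℝ × E, z.1 ^ 2 * ⟪lap V z, X₃ z⟫ = ∫ z : ℝ × E, z.1 ^ 2 * ⟪X₃ z, lap V z⟫ :=
      integral_congr_ae (Eventually.of_forall fun z => by
        show z.1 ^ 2 * ⟪lap V z, X₃ z⟫ = z.1 ^ 2 * ⟪X₃ z, lap V z⟫; rw [real_inner_comm])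
    rw [e, hX₃, h, hH]
    ring
  have E4 : 2 * ∫ z : ℝ × E, -(z.1 ^ 2 * lap φ z * ⟪lap V z, V z⟫) =
      -(∫ z : ℝ × E, z.1 ^ 2 * lap (lap φ) z * ‖V z‖ ^ 2) +
        2 * ∫ z : ℝ × E, z.1 ^ 2 * lap φ z * gradSq V z := by
    have h := integral_sq_mul_lap_mul_inner_lap hΩ hφ hV hVc hVΩ
    rw [integral_neg]
    have e : ∫ z : ℝ × E, z.1 ^ 2 * lap φ z * ⟪lap V z, V z⟫ =
        ∫ z : ℝ × E, z.1 ^ 2 * lap φ z * ⟪V z, lap V z⟫ :=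
      integral_congr_ae (Eventually.of_forall fun z => by
        show z.1 ^ 2 * lap φ z * ⟪lap V z, V z⟫ = z.1 ^ 2 * lap φ z * ⟪V z, lap V z⟫
        rw [real_inner_comm])
    rw [e, h]
    ring
  have E5 := two_mul_integral_sq_mul_qW_mul_inner_dt hΩ hφ hV hVc hVΩ (V := V)
  have E7 : 2 * ∫ z : ℝ × E, (-2) * (z.1 ^ 2 * qW φ z * ⟪V z, X₃ z⟫) =
      2 * ∫ z : ℝ × E, z.1 ^ 2 * (fderiv ℝ (qW φ) z (0, gradX φ z) + qW φ z * lap φ z) * ‖V z‖ ^ 2 := by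
    have h := two_mul_integral_sq_mul_qW_mul_inner_fderiv_gradX hΩ hφ hV hVc hVΩ
    rw [integral_const_mul]
    have e : ∫ z : ℝ × E, z.1 ^ 2 * qW φ z * ⟪V z, X₃ z⟫ =
        ∫ z : ℝ × E, z.1 ^ 2 * qW φ z * ⟪X₃ z, V z⟫ :=
      integral_congr_ae (Eventually.of_forall fun z => by
        show z.1 ^ 2 * qW φ z * ⟪V z, X₃ z⟫ = z.1 ^ 2 * qW φ z * ⟪X₃ z, V z⟫; rw [real_inner_comm])
    rw [e, hX₃]
    linarith [h]
  have E9 : 2 * ∫ z : ℝ × E, (-(1 / 2)) * (z.1 * ⟪V z, dt V z⟫) = 1 / 2 * ∫ z : ℝ × E, ‖V z‖ ^ 2 := by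
    have h := two_mul_integral_mul_inner_dt_self hδ (g := fun t => t) contDiff_id hV1 hVc hVδ
    simp only [deriv_id'', one_mul] at h
    rw [integral_const_mul]
    linarith [h]
  have E11 : 2 * ∫ z : ℝ × E, z.1 * ⟪V z, X₃ z⟫ = -∫ z : ℝ × E, z.1 * lap φ z * ‖V z‖ ^ 2 := by
    have h := two_mul_integral_fst_mul_inner_fderiv_gradX hΩ hV hVc hVΩ hφ
    have e : ∫ z : ℝ × E, z.1 * ⟪V z, X₃ z⟫ = ∫ z : ℝ × E, z.1 * ⟪X₃ z, V z⟫ :=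
      integral_congr_ae (Eventually.of_forall fun z => by
        show z.1 * ⟪V z, X₃ z⟫ = z.1 * ⟪X₃ z, V z⟫; rw [real_inner_comm])
    rw [e, hX₃, h]
  have EZ : 2 * ∫ z : ℝ × E, Zw z * ‖V z‖ ^ 2 = ∫ z : ℝ × E, 2 * Zw z * ‖V z‖ ^ 2 := by
    rw [← integral_const_mul]
    refine integral_congr_ae (Eventually.of_forall fun z => ?_)
    show 2 * (Zw z * ‖V z‖ ^ 2) = 2 * Zw z * ‖V z‖ ^ 2
    ring
  -- ## collecting the zeroth-order weights
  have j5 := integrable_mul_norm_sq_of_open hΩ hV hVc hVΩ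
    (w := fun z => 2 * z.1 * qW φ z + z.1 ^ 2 * dt (qW φ) z)
    (((continuousOn_const.mul ct).mul cq).add (ct2.mul cdtq))
  have j7 := integrable_mul_norm_sq_of_open hΩ hV hVc hVΩ
    (w := fun z => z.1 ^ 2 * (fderiv ℝ (qW φ) z (0, gradX φ z) + qW φ z * lap φ z))
    (ct2.mul (cdq.add (cq.mul clapφ)))
  have j9 := integrable_mul_norm_sq_of_open hΩ hV hVc hVΩ (w := fun _ => (1 : ℝ)) continuousOn_const
  have j11 := integrable_mul_norm_sq_of_open hΩ hV hVc hVΩ (w := fun z => z.1 * lap φ z) (ct.mul clapφ)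
  have jZ := integrable_mul_norm_sq_of_open hΩ hV hVc hVΩ (w := fun z => 2 * Zw z) (continuousOn_const.mul cZw)
  have j4 := integrable_mul_norm_sq_of_open hΩ hV hVc hVΩ (w := fun z => z.1 ^ 2 * lap (lap φ) z)
    (ct2.mul clap2φ)
  have jR := integrable_mul_norm_sq_of_open hΩ hV hVc hVΩ
    (w := fun z => z.1 ^ 2 * (dt (dt φ) z - dt (fun y => ‖gradX φ y‖ ^ 2) z - lap (lap φ) z +
      2 * fderiv ℝ (qW φ) z (0, gradX φ z)))
    (ct2.mul (((cdtdt.sub cdtg).sub clap2φ).add (continuousOn_const.mul cdq)))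
  have jq := integrable_mul_norm_sq_of_open hΩ hV hVc hVΩ (w := fun z => z.1 * qW φ z) (ct.mul cq)
  have hcollect :
      -(∫ z : ℝ × E, (2 * z.1 * qW φ z + z.1 ^ 2 * dt (qW φ) z) * ‖V z‖ ^ 2) +
      2 * (∫ z : ℝ × E, z.1 ^ 2 * (fderiv ℝ (qW φ) z (0, gradX φ z) + qW φ z * lap φ z) * ‖V z‖ ^ 2) +
      1 / 2 * (∫ z : ℝ × E, (1 : ℝ) * ‖V z‖ ^ 2) +
      (-(∫ z : ℝ × E, z.1 * lap φ z * ‖V z‖ ^ 2)) +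
      (∫ z : ℝ × E, 2 * Zw z * ‖V z‖ ^ 2) +
      (-(∫ z : ℝ × E, z.1 ^ 2 * lap (lap φ) z * ‖V z‖ ^ 2)) =
      (∫ z : ℝ × E, z.1 ^ 2 * (dt (dt φ) z - dt (fun y => ‖gradX φ y‖ ^ 2) z - lap (lap φ) z +
          2 * fderiv ℝ (qW φ) z (0, gradX φ z)) * ‖V z‖ ^ 2) -
        ∫ z : ℝ × E, z.1 * qW φ z * ‖V z‖ ^ 2 := by
    -- everything under one integral
    have k7 : Integrable (fun z : ℝ × E =>
        2 * (z.1 ^ 2 * (fderiv ℝ (qW φ) z (0, gradX φ z) + qW φ z * lap φ z) * ‖V z‖ ^ 2)) := j7.const_mul 2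
    have k9 : Integrable (fun z : ℝ × E => 1 / 2 * ((1 : ℝ) * ‖V z‖ ^ 2)) := j9.const_mul _
    have k5 : Integrable (fun z : ℝ × E => -((2 * z.1 * qW φ z + z.1 ^ 2 * dt (qW φ) z) * ‖V z‖ ^ 2)) := j5.neg
    have k11 : Integrable (fun z : ℝ × E => -(z.1 * lap φ z * ‖V z‖ ^ 2)) := j11.neg
    have k4 : Integrable (fun z : ℝ × E => -(z.1 ^ 2 * lap (lap φ) z * ‖V z‖ ^ 2)) := j4.neg
    have s1 : Integrable (fun z : ℝ × E => -((2 * z.1 * qW φ z + z.1 ^ 2 * dt (qW φ) z) * ‖V z‖ ^ 2) +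
        2 * (z.1 ^ 2 * (fderiv ℝ (qW φ) z (0, gradX φ z) + qW φ z * lap φ z) * ‖V z‖ ^ 2)) := k5.add k7
    have s2 : Integrable (fun z : ℝ × E => -((2 * z.1 * qW φ z + z.1 ^ 2 * dt (qW φ) z) * ‖V z‖ ^ 2) +
        2 * (z.1 ^ 2 * (fderiv ℝ (qW φ) z (0, gradX φ z) + qW φ z * lap φ z) * ‖V z‖ ^ 2) +
        1 / 2 * ((1 : ℝ) * ‖V z‖ ^ 2)) := s1.add k9
    have s3 : Integrable (fun z : ℝ × E => -((2 * z.1 * qW φ z + z.1 ^ 2 * dt (qW φ) z) * ‖V z‖ ^ 2) +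
        2 * (z.1 ^ 2 * (fderiv ℝ (qW φ) z (0, gradX φ z) + qW φ z * lap φ z) * ‖V z‖ ^ 2) +
        1 / 2 * ((1 : ℝ) * ‖V z‖ ^ 2) + -(z.1 * lap φ z * ‖V z‖ ^ 2)) := s2.add k11
    have s4 : Integrable (fun z : ℝ × E => -((2 * z.1 * qW φ z + z.1 ^ 2 * dt (qW φ) z) * ‖V z‖ ^ 2) +
        2 * (z.1 ^ 2 * (fderiv ℝ (qW φ) z (0, gradX φ z) + qW φ z * lap φ z) * ‖V z‖ ^ 2) +
        1 / 2 * ((1 : ℝ) * ‖V z‖ ^ 2) + -(z.1 * lap φ z * ‖V z‖ ^ 2) + 2 * Zw z * ‖V z‖ ^ 2) := s3.add jZ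
    rw [← integral_neg, ← integral_const_mul, ← integral_const_mul, ← integral_neg, ← integral_neg,
      ← integral_add k5 k7, ← integral_add s1 k9, ← integral_add s2 k11, ← integral_add s3 jZ,
      ← integral_add s4 k4, ← integral_sub jR jq]
    refine integral_congr_ae (Eventually.of_forall fun z => ?_)
    by_cases hz : z ∈ Ω
    · show -((2 * z.1 * qW φ z + z.1 ^ 2 * dt (qW φ) z) * ‖V z‖ ^ 2) +
          2 * (z.1 ^ 2 * (fderiv ℝ (qW φ) z (0, gradX φ z) + qW φ z * lap φ z) * ‖V z‖ ^ 2) +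
          1 / 2 * ((1 : ℝ) * ‖V z‖ ^ 2) + -(z.1 * lap φ z * ‖V z‖ ^ 2) + 2 * Zw z * ‖V z‖ ^ 2 +
          -(z.1 ^ 2 * lap (lap φ) z * ‖V z‖ ^ 2) =
        z.1 ^ 2 * (dt (dt φ) z - dt (fun y => ‖gradX φ y‖ ^ 2) z - lap (lap φ) z +
          2 * fderiv ℝ (qW φ) z (0, gradX φ z)) * ‖V z‖ ^ 2 - z.1 * qW φ z * ‖V z‖ ^ 2
      rw [dt_qW hΩ hφ hz]
      simp only [hZw]
      ring
    · simp [hV00 z hz]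
  -- ## assembly
  have s12 : Integrable (fun z : ℝ × E => z.1 ^ 2 * ⟪lap V z, dt V z⟫ + 1 / 2 * (z.1 * ⟪lap V z, V z⟫)) :=
    i1.add i2
  have s123 : Integrable (fun z : ℝ × E => z.1 ^ 2 * ⟪lap V z, dt V z⟫ + 1 / 2 * (z.1 * ⟪lap V z, V z⟫) +
      (-2) * (z.1 ^ 2 * ⟪lap V z, X₃ z⟫)) := s12.add i3
  have s1234 : Integrable (fun z : ℝ × E => z.1 ^ 2 * ⟪lap V z, dt V z⟫ + 1 / 2 * (z.1 * ⟪lap V z, V z⟫) +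
      (-2) * (z.1 ^ 2 * ⟪lap V z, X₃ z⟫) + (-(z.1 ^ 2 * lap φ z * ⟪lap V z, V z⟫))) := s123.add i4
  have s5 : Integrable (fun z : ℝ × E => z.1 ^ 2 * ⟪lap V z, dt V z⟫ + 1 / 2 * (z.1 * ⟪lap V z, V z⟫) +
      (-2) * (z.1 ^ 2 * ⟪lap V z, X₃ z⟫) + (-(z.1 ^ 2 * lap φ z * ⟪lap V z, V z⟫)) +
      z.1 ^ 2 * qW φ z * ⟪V z, dt V z⟫) := s1234.add i5
  have s7 : Integrable (fun z : ℝ × E => z.1 ^ 2 * ⟪lap V z, dt V z⟫ + 1 / 2 * (z.1 * ⟪lap V z, V z⟫) +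
      (-2) * (z.1 ^ 2 * ⟪lap V z, X₃ z⟫) + (-(z.1 ^ 2 * lap φ z * ⟪lap V z, V z⟫)) +
      z.1 ^ 2 * qW φ z * ⟪V z, dt V z⟫ + (-2) * (z.1 ^ 2 * qW φ z * ⟪V z, X₃ z⟫)) := s5.add i7
  have s9 : Integrable (fun z : ℝ × E => z.1 ^ 2 * ⟪lap V z, dt V z⟫ + 1 / 2 * (z.1 * ⟪lap V z, V z⟫) +
      (-2) * (z.1 ^ 2 * ⟪lap V z, X₃ z⟫) + (-(z.1 ^ 2 * lap φ z * ⟪lap V z, V z⟫)) +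
      z.1 ^ 2 * qW φ z * ⟪V z, dt V z⟫ + (-2) * (z.1 ^ 2 * qW φ z * ⟪V z, X₃ z⟫) +
      (-(1 / 2)) * (z.1 * ⟪V z, dt V z⟫)) := s7.add i9
  have s11 : Integrable (fun z : ℝ × E => z.1 ^ 2 * ⟪lap V z, dt V z⟫ + 1 / 2 * (z.1 * ⟪lap V z, V z⟫) +
      (-2) * (z.1 ^ 2 * ⟪lap V z, X₃ z⟫) + (-(z.1 ^ 2 * lap φ z * ⟪lap V z, V z⟫)) +
      z.1 ^ 2 * qW φ z * ⟪V z, dt V z⟫ + (-2) * (z.1 ^ 2 * qW φ z * ⟪V z, X₃ z⟫) +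
      (-(1 / 2)) * (z.1 * ⟪V z, dt V z⟫) + z.1 * ⟪V z, X₃ z⟫) := s9.add i11
  have hsplit : ∫ z, ⟪opSW φ V z, opAW φ V z⟫ =
      (∫ z : ℝ × E, z.1 ^ 2 * ⟪lap V z, dt V z⟫) + (∫ z : ℝ × E, 1 / 2 * (z.1 * ⟪lap V z, V z⟫)) +
      (∫ z : ℝ × E, (-2) * (z.1 ^ 2 * ⟪lap V z, X₃ z⟫)) +
      (∫ z : ℝ × E, -(z.1 ^ 2 * lap φ z * ⟪lap V z, V z⟫)) +
      (∫ z : ℝ × E, z.1 ^ 2 * qW φ z * ⟪V z, dt V z⟫) +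
      (∫ z : ℝ × E, (-2) * (z.1 ^ 2 * qW φ z * ⟪V z, X₃ z⟫)) +
      (∫ z : ℝ × E, (-(1 / 2)) * (z.1 * ⟪V z, dt V z⟫)) + (∫ z : ℝ × E, z.1 * ⟪V z, X₃ z⟫) +
      ∫ z : ℝ × E, Zw z * ‖V z‖ ^ 2 := by
    rw [integral_congr_ae (Eventually.of_forall hexp), integral_add s11 iZ, integral_add s9 i11,
      integral_add s7 i9, integral_add s5 i7, integral_add s1234 i5, integral_add s123 i4,
      integral_add s12 i3, integral_add i1 i2]
  have e9' : (∫ z : ℝ × E, ‖V z‖ ^ 2) = ∫ z : ℝ × E, (1 : ℝ) * ‖V z‖ ^ 2 := by simp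
  rw [e9'] at E9
  calc 2 * ∫ z, ⟪opSW φ V z, opAW φ V z⟫
      = 2 * (∫ z : ℝ × E, z.1 ^ 2 * ⟪lap V z, dt V z⟫) + 2 * (∫ z : ℝ × E, 1 / 2 * (z.1 * ⟪lap V z, V z⟫)) +
        2 * (∫ z : ℝ × E, (-2) * (z.1 ^ 2 * ⟪lap V z, X₃ z⟫)) +
        2 * (∫ z : ℝ × E, -(z.1 ^ 2 * lap φ z * ⟪lap V z, V z⟫)) +
        2 * (∫ z : ℝ × E, z.1 ^ 2 * qW φ z * ⟪V z, dt V z⟫) +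
        2 * (∫ z : ℝ × E, (-2) * (z.1 ^ 2 * qW φ z * ⟪V z, X₃ z⟫)) +
        2 * (∫ z : ℝ × E, (-(1 / 2)) * (z.1 * ⟪V z, dt V z⟫)) + 2 * (∫ z : ℝ × E, z.1 * ⟪V z, X₃ z⟫) +
        2 * ∫ z : ℝ × E, Zw z * ‖V z‖ ^ 2 := by rw [hsplit]; ring
    _ = (∫ z : ℝ × E, z.1 * gradSq V z) + 4 * H +
        (-(∫ z : ℝ × E, (2 * z.1 * qW φ z + z.1 ^ 2 * dt (qW φ) z) * ‖V z‖ ^ 2) +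
        2 * (∫ z : ℝ × E, z.1 ^ 2 * (fderiv ℝ (qW φ) z (0, gradX φ z) + qW φ z * lap φ z) * ‖V z‖ ^ 2) +
        1 / 2 * (∫ z : ℝ × E, (1 : ℝ) * ‖V z‖ ^ 2) +
        (-(∫ z : ℝ × E, z.1 * lap φ z * ‖V z‖ ^ 2)) +
        (∫ z : ℝ × E, 2 * Zw z * ‖V z‖ ^ 2) +
        (-(∫ z : ℝ × E, z.1 ^ 2 * lap (lap φ) z * ‖V z‖ ^ 2))) := by
        rw [E1, E2, E3, E4, E5, E7, E9, E11, EZ]; ring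
    _ = _ := by rw [hcollect]; ring

/-! #### The printed form of (A.1.6): `2∇q·∇φ = 4 φᵢⱼφᵢφⱼ - ∂ₜ|∇φ|²` -/

omit [FiniteDimensional ℝ E] [MeasurableSpace E] [BorelSpace E] hδ hV hVc hVΩ hVδ in
/-- Schwarz for the weight on `Ω`: `∂ₑ∂ₜφ = ∂ₜ∂ₑφ`. [folklore] -/
theorem dx_dt_eq_dt_dx_of_open {z : ℝ × E} (hz : z ∈ Ω) (e : E) :
    dx e (dt φ) z = dt (dx e φ) z := by
  have hφz : ContDiffAt ℝ (⊤ : ℕ∞) φ z := hφ.contDiffAt (hΩ.mem_nhds hz)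
  have hφ2 : ContDiffAt ℝ 2 φ z := hφz.of_le (WithTop.coe_le_coe.2 le_top)
  have hd : DifferentiableAt ℝ (fderiv ℝ φ) z :=
    (hφ2.fderiv_right (m := 1) le_rfl).differentiableAt one_ne_zero
  simp only [dx_apply, dt_apply]
  rw [show dt φ = fun y => fderiv ℝ φ y (1, 0) from rfl,
    show dx e φ = fun y => fderiv ℝ φ y (0, e) from rfl,
    fderiv_clm_apply hd (differentiableAt_const _), fderiv_clm_apply hd (differentiableAt_const _)]
  simp only [_root_.add_apply, ContinuousLinearMap.comp_apply, ContinuousLinearMap.flip_apply,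
    fderiv_fun_const, Pi.zero_apply, zero_apply]
  rw [(hφ2.isSymmSndFDerivAt (by simp)).eq (0, e) (1, 0)]

omit [MeasurableSpace E] [BorelSpace E] hδ hV hVc hVΩ hVδ in
/-- `D(|∇ₓφ|²)(z) w = 2 Σⱼ ∂ⱼφ · ∂_w∂ⱼφ` on `Ω`. [folklore] -/
theorem fderiv_norm_gradX_sq_apply {z : ℝ × E} (hz : z ∈ Ω) (w : ℝ × E) :
    fderiv ℝ (fun y => ‖gradX φ y‖ ^ 2) z w =
      2 * ∑ j, dx (stdOrthonormalBasis ℝ E j) φ z *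
        fderiv ℝ (dx (stdOrthonormalBasis ℝ E j) φ) z w := by
  set b := stdOrthonormalBasis ℝ E with hb
  have hgd : DifferentiableAt ℝ (gradX φ) z :=
    ((contDiffOn_gradX hΩ hφ).differentiableOn (by simp)).differentiableAt (hΩ.mem_nhds hz)
  rw [hgd.hasFDerivAt.norm_sq.fderiv]
  simp only [_root_.smul_apply, ContinuousLinearMap.comp_apply, innerSL_apply_apply]
  have hsum : ⟪gradX φ z, fderiv ℝ (gradX φ) z w⟫ =
      ∑ j, ⟪gradX φ z, b j⟫ * ⟪b j, fderiv ℝ (gradX φ) z w⟫ :=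
    ((stdOrthonormalBasis ℝ E).sum_inner_mul_inner (gradX φ z) (fderiv ℝ (gradX φ) z w)).symm
  simp only [nsmul_eq_mul, Nat.cast_ofNat]
  rw [hsum, Finset.mul_sum, Finset.mul_sum]
  refine Finset.sum_congr rfl fun j _ => ?_
  rw [real_inner_comm (fderiv ℝ (gradX φ) z w) (b j), inner_fderiv_gradX_apply hΩ hφ hz,
    inner_gradX_basis]
  rfl

omit [MeasurableSpace E] [BorelSpace E] hδ hV hVc hVΩ hVδ in
/-- **`2 Dq(0, ∇φ) = 4 Σᵢⱼ φᵢⱼ φᵢ φⱼ - ∂ₜ|∇φ|²`** on `Ω` (`q = |∇φ|² - ∂ₜφ`; Schwarz `∂ᵢ∂ₜφ = ∂ₜ∂ᵢφ`).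
This converts the raw weight of `two_mul_integral_inner_opSW_opAW` into the printed (A.1.6). [cite: Seregin2014, App. A.1 (A.1.6)] -/
theorem two_mul_fderiv_qW_apply_gradX {z : ℝ × E} (hz : z ∈ Ω) :
    2 * fderiv ℝ (qW φ) z (0, gradX φ z) =
      4 * (∑ i, ∑ j, dx (stdOrthonormalBasis ℝ E i) (dx (stdOrthonormalBasis ℝ E j) φ) z *
          dx (stdOrthonormalBasis ℝ E i) φ z * dx (stdOrthonormalBasis ℝ E j) φ z) -
        dt (fun y => ‖gradX φ y‖ ^ 2) z := by
  set b := stdOrthonormalBasis ℝ E with hb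
  have h1 : DifferentiableAt ℝ (fun y => ‖gradX φ y‖ ^ 2) z :=
    (((contDiffOn_gradX hΩ hφ).norm_sq ℝ).differentiableOn (by simp)).differentiableAt (hΩ.mem_nhds hz)
  have h2 : DifferentiableAt ℝ (dt φ) z :=
    ((contDiffOn_dt hΩ hφ).differentiableOn (by simp)).differentiableAt (hΩ.mem_nhds hz)
  have hsub : fderiv ℝ (qW φ) z (0, gradX φ z) =
      fderiv ℝ (fun y => ‖gradX φ y‖ ^ 2) z (0, gradX φ z) - fderiv ℝ (dt φ) z (0, gradX φ z) := by
    rw [show (qW φ : ℝ × E → ℝ) = fun y => (fun y => ‖gradX φ y‖ ^ 2) y - dt φ y from rfl,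
      fderiv_fun_sub h1 h2]
    rfl
  have hgi : ∀ i, ⟪gradX φ z, b i⟫ = dx (b i) φ z := fun i => inner_gradX_basis φ z i
  -- the gradient part
  have hA : fderiv ℝ (fun y => ‖gradX φ y‖ ^ 2) z (0, gradX φ z) =
      2 * ∑ i, ∑ j, dx (b i) (dx (b j) φ) z * dx (b i) φ z * dx (b j) φ z := by
    rw [fderiv_norm_gradX_sq_apply hΩ hφ hz, Finset.sum_comm]
    simp only [← hb]
    congr 1
    refine Finset.sum_congr rfl fun j _ => ?_
    rw [fderiv_apply_zero_eq_sum (dx (b j) φ) z (gradX φ z), Finset.mul_sum]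
    simp only [← hb]
    refine Finset.sum_congr rfl fun i _ => ?_
    rw [hgi i, ← dx_apply (b i) (dx (b j) φ) z]
    ring
  -- the time part: `D(∂ₜφ)(0,∇φ) = Σᵢ φᵢ ∂ₜ∂ᵢφ = ½ ∂ₜ|∇φ|²`
  have hB : fderiv ℝ (dt φ) z (0, gradX φ z) = 1 / 2 * dt (fun y => ‖gradX φ y‖ ^ 2) z := by
    rw [fderiv_apply_zero_eq_sum (dt φ) z (gradX φ z), dt_apply, fderiv_norm_gradX_sq_apply hΩ hφ hz,
      Finset.mul_sum, Finset.mul_sum]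
    simp only [← hb]
    refine Finset.sum_congr rfl fun i _ => ?_
    rw [hgi i, ← dx_apply (b i) (dt φ) z, dx_dt_eq_dt_dx_of_open hΩ hφ hz, dt_apply]
    ring
  rw [hsub, hA, hB]
  ring

/-- **The commutator identity in the printed form (A.1.6)**:
`2 ∫ ⟪S v, A v⟫ = ∫ t|∇v|² + 4 Σᵢⱼ ∫ t² φᵢⱼ ⟪∂ⱼv, ∂ᵢv⟫ + 4 Σᵢⱼ ∫ t² φᵢⱼ φᵢ φⱼ |v|²
  + ∫ t² (∂ₜ²φ - 2∂ₜ|∇φ|² - Δ²φ) |v|² - ∫ t (|∇φ|² - ∂ₜφ) |v|²`. [cite: Seregin2014, App. A.1 (A.1.6)] -/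
theorem two_mul_integral_inner_opSW_opAW_printed :
    2 * ∫ z, ⟪opSW φ V z, opAW φ V z⟫ =
      (∫ z, z.1 * gradSq V z) +
      4 * (∑ i, ∑ j, ∫ z, z.1 ^ 2 * dx (stdOrthonormalBasis ℝ E i) (dx (stdOrthonormalBasis ℝ E j) φ) z *
          ⟪dx (stdOrthonormalBasis ℝ E j) V z, dx (stdOrthonormalBasis ℝ E i) V z⟫) +
      4 * (∫ z, z.1 ^ 2 * (∑ i, ∑ j, dx (stdOrthonormalBasis ℝ E i) (dx (stdOrthonormalBasis ℝ E j) φ) z *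
          dx (stdOrthonormalBasis ℝ E i) φ z * dx (stdOrthonormalBasis ℝ E j) φ z) * ‖V z‖ ^ 2) +
      (∫ z, z.1 ^ 2 * (dt (dt φ) z - 2 * dt (fun y => ‖gradX φ y‖ ^ 2) z - lap (lap φ) z) * ‖V z‖ ^ 2) -
      ∫ z, z.1 * qW φ z * ‖V z‖ ^ 2 := by
  rw [two_mul_integral_inner_opSW_opAW hΩ hφ hδ hV hVc hVΩ hVδ]
  have hV00 : ∀ z ∉ Ω, V z = 0 := fun z hz => image_eq_zero_of_notMem_tsupport fun h => hz (hVΩ h)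
  have ct2 : ContinuousOn (fun z : ℝ × E => z.1 ^ 2) Ω := (continuous_fst.pow 2).continuousOn
  have clap2φ : ContinuousOn (lap (lap φ)) Ω :=
    (contDiffOn_lap_of_open hΩ (contDiffOn_lap_of_open hΩ hφ)).continuousOn
  have cdtdt : ContinuousOn (dt (dt φ)) Ω :=
    (contDiffOn_fderiv_apply_const_of_open hΩ (contDiffOn_dt hΩ hφ) _).continuousOn
  have cdtg : ContinuousOn (dt (fun y => ‖gradX φ y‖ ^ 2)) Ω :=
    (contDiffOn_fderiv_apply_const_of_open hΩ ((contDiffOn_gradX hΩ hφ).norm_sq ℝ) _).continuousOn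
  have cφij : ∀ i j, ContinuousOn (fun z => dx (stdOrthonormalBasis ℝ E i)
      (dx (stdOrthonormalBasis ℝ E j) φ) z) Ω := fun i j =>
    (contDiffOn_fderiv_apply_const_of_open hΩ (contDiffOn_dx hΩ hφ _) _).continuousOn
  have cφi : ∀ i, ContinuousOn (dx (stdOrthonormalBasis ℝ E i) φ) Ω := fun i =>
    (contDiffOn_dx hΩ hφ _).continuousOn
  have cS : ContinuousOn (fun z => ∑ i, ∑ j, dx (stdOrthonormalBasis ℝ E i)
      (dx (stdOrthonormalBasis ℝ E j) φ) z * dx (stdOrthonormalBasis ℝ E i) φ z *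
        dx (stdOrthonormalBasis ℝ E j) φ z) Ω :=
    continuousOn_finsetSum _ fun i _ => continuousOn_finsetSum _ fun j _ =>
      ((cφij i j).mul (cφi i)).mul (cφi j)
  have cdq : ContinuousOn (fun z => fderiv ℝ (qW φ) z (0, gradX φ z)) Ω :=
    ((contDiffOn_qW hΩ hφ).continuousOn_fderiv_of_isOpen hΩ (by simp)).clm_apply
      (continuousOn_const.prodMk (contDiffOn_gradX hΩ hφ).continuousOn)
  have jS := integrable_mul_norm_sq_of_open hΩ hV hVc hVΩ (ct2.mul cS)
  have jP := integrable_mul_norm_sq_of_open hΩ hV hVc hVΩ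
    (w := fun z => z.1 ^ 2 * (dt (dt φ) z - 2 * dt (fun y => ‖gradX φ y‖ ^ 2) z - lap (lap φ) z))
    (ct2.mul ((cdtdt.sub (continuousOn_const.mul cdtg)).sub clap2φ))
  have key : (∫ z, z.1 ^ 2 * (dt (dt φ) z - dt (fun y => ‖gradX φ y‖ ^ 2) z - lap (lap φ) z +
      2 * fderiv ℝ (qW φ) z (0, gradX φ z)) * ‖V z‖ ^ 2) =
      4 * (∫ z, z.1 ^ 2 * (∑ i, ∑ j, dx (stdOrthonormalBasis ℝ E i) (dx (stdOrthonormalBasis ℝ E j) φ) z *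
          dx (stdOrthonormalBasis ℝ E i) φ z * dx (stdOrthonormalBasis ℝ E j) φ z) * ‖V z‖ ^ 2) +
      ∫ z, z.1 ^ 2 * (dt (dt φ) z - 2 * dt (fun y => ‖gradX φ y‖ ^ 2) z - lap (lap φ) z) * ‖V z‖ ^ 2 := by
    have kS : Integrable (fun z => 4 * (z.1 ^ 2 * (∑ i, ∑ j, dx (stdOrthonormalBasis ℝ E i)
        (dx (stdOrthonormalBasis ℝ E j) φ) z * dx (stdOrthonormalBasis ℝ E i) φ z *
          dx (stdOrthonormalBasis ℝ E j) φ z) * ‖V z‖ ^ 2)) := jS.const_mul 4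
    rw [← integral_const_mul, ← integral_add kS jP]
    refine integral_congr_ae (Eventually.of_forall fun z => ?_)
    by_cases hz : z ∈ Ω
    · show z.1 ^ 2 * (dt (dt φ) z - dt (fun y => ‖gradX φ y‖ ^ 2) z - lap (lap φ) z +
          2 * fderiv ℝ (qW φ) z (0, gradX φ z)) * ‖V z‖ ^ 2 =
        4 * (z.1 ^ 2 * (∑ i, ∑ j, dx (stdOrthonormalBasis ℝ E i) (dx (stdOrthonormalBasis ℝ E j) φ) z *
          dx (stdOrthonormalBasis ℝ E i) φ z * dx (stdOrthonormalBasis ℝ E j) φ z) * ‖V z‖ ^ 2) +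
        z.1 ^ 2 * (dt (dt φ) z - 2 * dt (fun y => ‖gradX φ y‖ ^ 2) z - lap (lap φ) z) * ‖V z‖ ^ 2
      rw [two_mul_fderiv_qW_apply_gradX hΩ hφ hz]
      ring
    · simp [hV00 z hz]
  rw [key]
  ring

end Commutator

end Carleman

end Literature.Analysis.FluidPDE
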